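import Literature.AnabelianGeometry.AbsoluteAnabelian.AbsTopIII.Thm19CuspidalDegree
import Literature.AnabelianGeometry.AbsoluteAnabelian.AbsTopIII.Thm19Steps
import HarnessLib

/-!
# [AbsTopIII] §1: per-curve LAWS of the model interface — cofinite opens, Kummer naturality,
# cuspidal degrees, separation of points, evaluation (successor structure of `IntrinsicKummerModel`)

Mochizuki, *Topics in Absolute Anabelian Geometry III*, §1 (manuscript pages, lit key
`paper:url-5493eb38cbb7`): p. 29 "Write `K_X` for the function field of `X`"; Prop. 1.4 p. 31
("`U ⊆ X` a nonempty open subscheme", "`U_x := X ∖ {x}`"); Prop. 1.6 pp. 34–35 ("the associated Kummer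
map [cf., e.g., the discussion at the beginning of [Mzk19], §2]"; (iii) "`U = X ∖ S`, where `S ⊆ X(k)` is
a finite subset [...] restricting cohomology classes of `Π_U` to the various `I_x` [...] where we
identify `Hom_Ẑ(I_x, M_X)` with `Ẑ` via the isomorphism `I_x ⥲ M_X` of Proposition 1.4, (ii) [...] the
image [via `κ_U`] of `Γ(U, 𝒪_U^×)` [...] is equal to the inverse image [...] of the submodule of `⊕_{x∈S} ℤ`
[...] determined by the principal divisors"); Def. 1.7 (ii) p. 35 (NF-points, NF-rational functions,
NF-constants); Prop. 1.8 p. 36 ("`η|_{x_i} := s_{x_i}^*(η) ∈ H¹(G_{k_x}, M_X)`").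

The one-base-field interface `CurveModel` ⊆ `DivisorCurveModel` ⊆ `IntrinsicKummerModel`
(abc-iut-L4-t1, files `CurveModel.lean`, `DivisorSections.lean`, `KummerIntrinsic.lean`) records the
function field, the closed points, `ord`, and the Kummer map `κ_U` PER CURVE and the surjections
`Π_U ↠ Π_X` of cofinite opens, but NO law relating these data ALONG a cofinite open `U ⊆ X` — cell
abc-iut GAP-LEDGER rows G-w5d213-1 (naturality of `κ`; (I1) `K_U = K_X`, (I2) `Point U ↪ Point X`),
G-w5d213-2 (a)(b), G-w5d213-3 (e2)(e3).  THIS FILE is the interface OWNER's successor structure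
`NaturalKummerModel extends IntrinsicKummerModel` carrying exactly those PER-CURVE laws (frozen files
untouched; abc-iut-L4-lead RULING #3y (1) 2026-08-26).  Every field is INTERFACE DATA / an INTERFACE
LAW in the sense of the cell's typing policy θ (plan/L4/ASSIGNMENTS.md §2): TRUE at the intended
étale-`π₁` model (curves with generic-point base points, so that the `Π_U ↠ Π_X` compose on the nose),
NOT a published prerequisite, NOT a named Prop fact; no instance is asserted.  Groups of fields:

* (O) cofinite opens: `res_comp` (functoriality of `res`, which `CurveModel` lacks), (I1) `fieldRes`
  ("`K_U = K_X`") with `baseRes`, (I2) `ptRes` (closed points of `U` are closed points of `X`,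
  compatibly with `ord`, decomposition groups, rationality, NF-points) and `cuspPt` (the point of
  `X ∖ U` a cusp of `U` fills — "`U = X ∖ S`", Prop. 1.6 (iii));
* (R) model closure: removing finitely many points / filling cusps back in stays inside the model
  (the opens "`U ⊆ X`", "`U ⊆ Z ∖ {z} ⊆ Z`" of Thm. 1.9 (a)(b) exist as curves of the model);
* (K) constants: `ord_const` (constants are regular units, G-w5d213-2 (b)), `isNFConstant_iff`
  (Def. 1.7 (ii) link, G-w5d213-2 (a));
* (N) NATURALITY of the Kummer maps along cofinite opens (G-w5d213-1 at the model level);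
* (D) the DEGREE LAW of Prop. 1.6 (iii), "`D ∘ κ_U = div`", at each cusp `z` of `U` read through a
  cyclotome presentation `U ⊆ U_z ⊆ X` (Thm. 1.9 (b)) and THE synchronization `inertiaSynchronization`
  of Prop. 1.4 (ii), with ONE sign datum `degSign` (see the field docstring);
* (S) separation of closed points by decomposition groups over Kummer-faithful fields (OURS: Prop.
  1.6 (ii) + "no rational function with a single simple pole in genus `≥ 1`"; needed because
  `IntrinsicKummerModel.Thm19c` quantifies over ALL `CuspSyncPresentation`s, whose `pt` is pinned only
  through decomposition groups);
* (E) evaluation of regular units at rational points and its compatibility with `κ_U|_{D_x}`.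

The per-SYSTEM view `IntrinsicKummerModel.NFTower` (abc-iut-w5-d213, `Thm19KummerTower.lean`) derives
its fields `res`/`res_injective`/`naturality` (open legs), `const_mem`, `isNFConstant_iff` from these
laws (bridge `NFTower.ofCurveLaws`, w5-d213); its base-change legs are the sequel file (FILE C).
HONEST FRAMING: statements-first interface laws; typed ≠ proved; nothing here bears on [IUTchIII]
Cor. 3.12.
-/

noncomputable section

open CategoryTheory
open scoped Classical Pointwise

namespace Literature.AnabelianGeometry.AbsoluteAnabelian.AbsTopIII

universe u

/-! ### The cuspidal degree predicate over explicit curves (no presentation data) -/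

namespace CurveModel

variable {M : CurveModel.{u}}

/-- **Integral cuspidal degree of a class of `Π_U` at a cusp `z`, read through a cyclotome
presentation `U ⊆ U_z ⊆ X`** ("restricting cohomology classes of `Π_U` to the various `I_x` [...] where
we identify `Hom_Ẑ(I_x, M_X)` with `Ẑ` via the isomorphism `I_x ⥲ M_X` of Proposition 1.4, (ii)", Prop.
1.6 (iii) p. 35; "via the technique of Proposition 1.4, (ii)", Thm. 1.9 (b) p. 37): for cofinite opens
`U ⊆ U_z ⊆ X` of the model (`h₁`, `h₂`, composite `h`), a cusp `z` of `U` whose inertia group maps into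
the inertia group of the cusp `x` of `U_z` (Prop. 1.4 (i)), `I_x` inside the cuspidal kernel of
`Π_{U_z} ↠ Π_X`, the class `η ∈ H¹(Π_U, M_X)` has degree `n ∈ ℤ` at `z` when `η|_{I_z}` is the class of the
crossed homomorphism `i ↦ n · sync_x(i|_{U_z})` for THE synchronization `inertiaSynchronization` of
`(U_z ⊆ X, x)` (section-independent, `inertiaSynchronization_eq`).  Same shape as abc-iut-w5-d213's
`HasCuspidalDegree P η z n`, with the presentation `P` replaced by explicit curves of the model.
[cite: MochizukiAbsTopIII2015, Prop 1.6 (iii) p.35] -/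
def HasDegreeAtCusp (M : CurveModel.{u}) {U Uz X : M.Curve} (h₁ : M.IsCofiniteOpen U Uz)
    (h₂ : M.IsCofiniteOpen Uz X) (h : M.IsCofiniteOpen U X) (z : (M.cusps U).Cusp)
    (x : (M.cusps Uz).Cusp) (hI : (M.cusps Uz).Icusp x ≤ cuspidalKernel (M.res h₂))
    (hle : ((M.cusps U).Icusp z).map (M.res h₁).arith.toMonoidHom ≤ (M.cusps Uz).Icusp x)
    (s : CcnSection (M.res h₂)) (hd : Function.Bijective (ccnTransgression (M.res h₂) ZHatCoeff.{u} s))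
    (η : cyclotomeModH1 (M.res h) ZHatCoeff.{u}) (n : ℤ) : Prop :=
  ∃ (hc : Continuous fun i : (M.cusps U).Icusp z =>
      n • CyclotomeMod.ofDual (inertiaSynchronization (M.res h₂) hI s hd
        (Additive.ofMul ⟨(M.res h₁).arith i, hle ⟨i, i.2, rfl⟩⟩)))
    (hf : ∀ a b : (M.cusps U).Icusp z,
      (⟨_, hc⟩ : C((M.cusps U).Icusp z, M.inertiaRep h z)) (a * b) =
        (⟨_, hc⟩ : C((M.cusps U).Icusp z, M.inertiaRep h z)) a +
          (M.inertiaRep h z).ρ a ((⟨_, hc⟩ : C((M.cusps U).Icusp z, M.inertiaRep h z)) b)),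
    cyclotomeModH1Res (M.res h) ZHatCoeff.{u} ((M.cusps U).Icusp z) η =
      ContinuousCohomology.crossedHomClass (M.inertiaRep h z) ⟨_, hc⟩ hf

end CurveModel

/-! ### The successor structure: per-curve laws -/

/-- **The model interface with its per-curve laws** (successor of `IntrinsicKummerModel`; cell abc-iut
GAP-LEDGER G-w5d213-1, G-w5d213-2, G-w5d213-3; interface owner abc-iut-L4-t1).  A `NaturalKummerModel` is an
`IntrinsicKummerModel` (curves, `1 → Δ_U → Π_U → G_k → 1`, cusps, `K_U`, closed points, `ord_x`,
sections of rational points, Kummer maps `κ_U`) TOGETHER WITH the laws relating these data along the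
cofinite opens `U ⊆ X` of the model ("`U ⊆ X` a nonempty open subscheme", Prop. 1.4 p. 31): the
function fields and points of `U` and `X` agree ("`K_X` [is] the function field of `X`", p. 29;
"`U = X ∖ S`", Prop. 1.6 (iii)), the Kummer map is natural ("the associated Kummer map", Prop. 1.6 p. 34),
its cuspidal degrees are the orders of the function (Prop. 1.6 (iii) "determined by the principal
divisors"), points are separated by their decomposition groups, and Kummer classes restrict to
decomposition groups of rational points as Kummer classes of values (Prop. 1.8 p. 36).  INTERFACE
(typing policy θ); no instance is asserted. [cite: MochizukiAbsTopIII2015, Prop 1.6 p.34] -/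
structure NaturalKummerModel : Type (u + 2) extends IntrinsicKummerModel.{u} where
  /-- (O) functoriality of the surjections of Prop. 1.4: for `U ⊆ U′ ⊆ X` cofinite opens,
  "`Π_U ↠ Π_{U′} ↠ Π_X`" is "`Π_U ↠ Π_X`" (generic-point base points; the composition law `CurveModel`
  lacks — carried as data by `CuspSyncPresentation.res_comp`). -/
  res_comp : ∀ {U U' X : Curve} (h₁ : IsCofiniteOpen U U') (h₂ : IsCofiniteOpen U' X)
    (h : IsCofiniteOpen U X), res h₁ ≫ res h₂ = res h
  /-- (I1) "`K_U = K_X`": "Write `K_X` for the function field of `X`" (p. 29) — a cofinite open has the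
  function field of its ambient curve. -/
  fieldRes : ∀ {U X : Curve}, IsCofiniteOpen U X → (FunctionField X ≃+* FunctionField U)
  /-- (I1) the base fields of `U ⊆ X` agree (`k_U = k_X`). -/
  baseRes : ∀ {U X : Curve}, IsCofiniteOpen U X → (base X ≃+* base U)
  /-- (I1) `K_X = K_U` over `k_X = k_U`: constants go to constants. -/
  fieldRes_algebraMap : ∀ {U X : Curve} (h : IsCofiniteOpen U X) (c : base X),
    fieldRes h (algebraMap (base X) (FunctionField X) c) =
      algebraMap (base U) (FunctionField U) (baseRes h c)
  /-- (I1) transitivity of "`K_U = K_{U′} = K_X`" along `U ⊆ U′ ⊆ X`. -/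
  fieldRes_comp : ∀ {U U' X : Curve} (h₁ : IsCofiniteOpen U U') (h₂ : IsCofiniteOpen U' X)
    (h : IsCofiniteOpen U X) (f : FunctionField X), fieldRes h f = fieldRes h₁ (fieldRes h₂ f)
  /-- (I2) the closed points of `U` are closed points of `X` ("`U ⊆ X` a nonempty open subscheme",
  Prop. 1.4 p. 31). -/
  ptRes : ∀ {U X : Curve}, IsCofiniteOpen U X → (Point U ↪ Point X)
  /-- (I2) transitivity of the point inclusions along `U ⊆ U′ ⊆ X`. -/
  ptRes_comp : ∀ {U U' X : Curve} (h₁ : IsCofiniteOpen U U') (h₂ : IsCofiniteOpen U' X)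
    (h : IsCofiniteOpen U X) (x : Point U), ptRes h x = ptRes h₂ (ptRes h₁ x)
  /-- (I2) "`ord_x : K_X^× → ℤ`" (Prop. 1.3 (b) p. 30) does not depend on the open in which the closed
  point `x` is viewed: `ord_x(f) = ord_x(f|_U)`. -/
  ord_ptRes : ∀ {U X : Curve} (h : IsCofiniteOpen U X) (x : Point U) (f : (FunctionField X)ˣ),
    ord (ptRes h x) f = ord x (Units.map (fieldRes h).toRingHom.toMonoidHom f)
  /-- (I2) the decomposition group of a closed point `x ∈ U` in `Π_U` maps onto a decomposition group
  of `x` in `Π_X` (Cor. 1.10 (e) p. 43 "decomposition groups [of closed points]"; both are copies of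
  `G_{k_x}`). -/
  decomp_ptRes : ∀ {U X : Curve} (h : IsCofiniteOpen U X) (x : Point U), ∃ g : (ext X).arith,
    (decomp U x).map (res h).arith.toMonoidHom = MulAut.conj g • decomp X (ptRes h x)
  /-- (I2) rationality of a closed point does not depend on the open ("`x ∈ X(k)`", Prop. 1.6 (ii)). -/
  isRationalPt_ptRes : ∀ {U X : Curve} (h : IsCofiniteOpen U X) (x : Point U),
    IsRationalPt X (ptRes h x) ↔ IsRationalPt U x
  /-- (I2) "`U = X ∖ S`, where `S` [...] is a finite subset" (Prop. 1.6 (iii) p. 35): the point of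
  `X ∖ U` that a cusp of `U` fills (`none` for the cusps of `U` that are cusps of `X`). -/
  cuspPt : ∀ {U X : Curve}, IsCofiniteOpen U X → (cusps U).Cusp → Option (Point X)
  /-- (I2) distinct cusps fill distinct points. -/
  cuspPt_inj : ∀ {U X : Curve} (h : IsCofiniteOpen U X) (c c' : (cusps U).Cusp) (y : Point X),
    cuspPt h c = some y → cuspPt h c' = some y → c = c'
  /-- (I2) a filled point is not a point of `U` ("`X ∖ S`"). -/
  cuspPt_ne_ptRes : ∀ {U X : Curve} (h : IsCofiniteOpen U X) (c : (cusps U).Cusp) (x : Point U),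
    cuspPt h c ≠ some (ptRes h x)
  /-- (I2) "`U = X ∖ S`": every closed point of `X` is a point of `U` or is filled by a cusp of `U`. -/
  exists_ptRes_or_cuspPt : ∀ {U X : Curve} (h : IsCofiniteOpen U X) (y : Point X),
    (∃ x : Point U, ptRes h x = y) ∨ ∃ c : (cusps U).Cusp, cuspPt h c = some y
  /-- (I2) when `X` is proper, every cusp of `U` fills a point of `X` (`X` has no cusps). -/
  cuspPt_isSome : ∀ {U X : Curve} (h : IsCofiniteOpen U X), IsProper X →
    ∀ c : (cusps U).Cusp, (cuspPt h c).isSome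
  /-- (I2) "the decomposition groups of the closed points of `X` lying in the complement of `U_X` may
  be obtained as the images via `Π_{U_X} ↠ Π` of the cuspidal decomposition groups" ([AbsTopII]
  Cor. 3.7 (c), quoted in Thm. 1.9 (a) p. 37): `D_c ⊆ Π_U` maps onto a decomposition group of the
  filled point. -/
  decomp_cuspPt : ∀ {U X : Curve} (h : IsCofiniteOpen U X) (c : (cusps U).Cusp) (y : Point X),
    cuspPt h c = some y → ∃ g : (ext X).arith,
      ((cusps U).Dcusp c).map (res h).arith.toMonoidHom = MulAut.conj g • decomp X y
  /-- (I2) the cusps of `U` that fill no point of `X` are cusps of `X`: their decomposition groups map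
  onto cuspidal decomposition groups of `X`. -/
  decomp_cuspPt_none : ∀ {U X : Curve} (h : IsCofiniteOpen U X) (c : (cusps U).Cusp),
    cuspPt h c = none → ∃ (c' : (cusps X).Cusp) (g : (ext X).arith),
      ((cusps U).Dcusp c).map (res h).arith.toMonoidHom = MulAut.conj g • (cusps X).Dcusp c'
  /-- (I2) a cusp is rational ("`z ∈ (Z ∖ U)(k_Z)`", Thm. 1.9 (b) p. 37) iff the point it fills is
  `k`-rational. -/
  isRational_cuspPt_iff : ∀ {U X : Curve} (h : IsCofiniteOpen U X) (c : (cusps U).Cusp)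
    (y : Point X), cuspPt h c = some y → ((cusps U).IsRational c ↔ IsRationalPt X y)
  /-- (O) a cofinite open of a scheme-like curve is scheme-like ("`U ⊆ X` a nonempty open subscheme",
  Prop. 1.4 p. 31). -/
  isScheme_of_isCofiniteOpen : ∀ {U X : Curve}, IsCofiniteOpen U X → IsScheme X → IsScheme U
  /-- (O) `U ⊆ X` cofinite open have the same compactification, hence the same genus. -/
  genus_eq_of_isCofiniteOpen : ∀ {U X : Curve}, IsCofiniteOpen U X → genus U = genus X
  /-- (R) model closure under REMOVING points ("`U ⊆ X` is an open subscheme obtained by removing an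
  arbitrary finite collection of [...] points", Thm. 1.9 (a) p. 37; "`U_x := X ∖ {x}`", Prop. 1.4 p. 31):
  for a scheme-like `X` and a finite set `T` of closed points, some cofinite open `U ⊆ X` of the model
  fills exactly `T`. -/
  exists_open_removing : ∀ (X : Curve) (T : Finset (Point X)), IsScheme X →
    ∃ (U : Curve) (h : IsCofiniteOpen U X), ∀ y : Point X, (∃ c, cuspPt h c = some y) ↔ y ∈ T
  /-- (R) model closure under FILLING cusps back in (the "third curves" `U ⊆ Z ∖ {z} ⊆ Z` of Thm. 1.9
  (b) p. 37): for `U ⊆ X` cofinite open and a set `T` of cusps of `U` filling points of `X`, some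
  intermediate cofinite open `U ⊆ U′ ⊆ X` of the model fills exactly the points of `T` (its remaining
  cusps are the cusps of `U` outside `T`). -/
  exists_open_between : ∀ {U X : Curve} (h : IsCofiniteOpen U X) (T : Set (cusps U).Cusp),
    (∀ c ∈ T, (cuspPt h c).isSome) →
    ∃ (U' : Curve) (h₁ : IsCofiniteOpen U U') (_ : IsCofiniteOpen U' X),
      ∀ c : (cusps U).Cusp, cuspPt h₁ c = none ↔ c ∉ T
  /-- (I2)/Def. 1.7: if `U` is an NF-curve then so is its compactification-mate `X ⊇ U` ("`X_{k̄}` is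
  defined over `k̄_NF`", Def. 1.7 (i) p. 35 — removing points and compactifying commute with descent). -/
  isNFCurve_of_isCofiniteOpen : ∀ {U X : Curve}, IsCofiniteOpen U X → IsNFCurve U → IsNFCurve X
  /-- Def. 1.7 (ii): for an NF-curve `U`, a closed point of `U` is an NF-point of `U` iff it is an
  NF-point of `X ⊇ U` ("points of `X(k̄)` [...] that descend to `k̄_NF`", p. 35). -/
  isNFPoint_ptRes : ∀ {U X : Curve} (h : IsCofiniteOpen U X), IsNFCurve U → ∀ x : Point U,
    IsNFPoint X (ptRes h x) ↔ IsNFPoint U x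
  /-- Def. 1.7 (ii): for an NF-curve `U`, NF-rationality of a function does not depend on the open
  ("rational functions on `X_{k̄}` [...] that descend to `k̄_NF`", p. 35; `K_U = K_X`). -/
  isNFRational_fieldRes : ∀ {U X : Curve} (h : IsCofiniteOpen U X), IsNFCurve U →
    ∀ g : FunctionField X, IsNFRational U (fieldRes h g) ↔ IsNFRational X g
  /-- Def. 1.7 (ii): for an NF-curve `U`, being an NF-constant does not depend on the open. -/
  isNFConstant_baseRes : ∀ {U X : Curve} (h : IsCofiniteOpen U X), IsNFCurve U →
    ∀ c : base X, IsNFConstant U (baseRes h c) ↔ IsNFConstant X c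
  /-- (K) constants have no zeros or poles: `ord_x(c) = 0` for `c ∈ k^×` (so constants are regular units,
  "`(k^×)^∧ → H¹(Π_U, M_X)`" in Prop. 1.6 (iii) p. 35; GAP G-w5d213-2 (b)). -/
  ord_const : ∀ {U : Curve} (x : Point U) (c : (base U)ˣ),
    ord x (Units.map (algebraMap (base U) (FunctionField U) : base U →* FunctionField U) c) = 1
  /-- (K) Def. 1.7 (ii) link (GAP G-w5d213-2 (a)): for an NF-curve `U`, `c ∈ k` is an NF-constant
  ("constant rational functions on `X_{k̄}` [...] that descend to `k̄_NF`") iff the constant function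
  `c` is an NF-rational function. -/
  isNFConstant_iff : ∀ {U : Curve}, IsNFCurve U → ∀ c : (base U)ˣ,
    IsNFConstant U (c : base U) ↔ IsNFRational U (algebraMap (base U) (FunctionField U) c)
  /-- (N) **NATURALITY of the Kummer map along cofinite opens** ("the associated Kummer map [cf., e.g.,
  the discussion at the beginning of [Mzk19], §2]", Prop. 1.6 p. 34; GAP G-w5d213-1 at the model
  level): for `U ⊆ U′ ⊆ X` with `X` proper and a regular unit `f` on `U′`, `κ_U(f|_U)` is the pull-back
  of `κ_{U′}(f)` along `Π_U ↠ Π_{U′}` over `Π_X` (`cyclotomeModH1Pull`; `f|_U` is a regular unit by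
  `ord_ptRes`). -/
  kummer_natural : ∀ {U U' X : Curve} (h₁ : IsCofiniteOpen U U') (h₂ : IsCofiniteOpen U' X)
    (h : IsCofiniteOpen U X) (hX : IsProper X) (f : toDivisorCurveModel.regularUnits U')
    (hf : Units.map (fieldRes h₁).toRingHom.toMonoidHom (f : (FunctionField U')ˣ) ∈
      toDivisorCurveModel.regularUnits U),
    toIntrinsicKummerModel.kummerAddHom h hX (Additive.ofMul ⟨_, hf⟩) =
      (cyclotomeModH1Pull ZHatCoeff.{u} (res h₁) (res h₂) (res h) (res_comp h₁ h₂ h)).hom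
        (toIntrinsicKummerModel.kummerAddHom h₂ hX (Additive.ofMul f))
  /-- (D) the SIGN relating THE synchronization `inertiaSynchronization` (Leray differential of the
  cuspidally central extension, Prop. 1.4 (ii), in the orientation conventions of the tree's
  `ContinuousCohomology.transgression`) to the Kummer-theoretic orientation of `I_x ≅ Ẑ(1)` in which
  cuspidal degrees are `+ord_x`.  OURS: print pins a `Π`-equivariant isomorphism of the rank-one free
  `Ẑ`-modules `I_x`, `M_X` only up to `Ẑ^×`; the integrality clause of Prop. 1.6 (iii) ("the submodule
  of `⊕ ℤ ⊆ ⊕ Ẑ` determined by the principal divisors") forces the unit into `ℤ ∩ Ẑ^× = {±1}`, a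
  universal convention constant — recorded as a datum rather than guessed. -/
  degSign : ℤˣ
  /-- (D) **the DEGREE LAW** (Prop. 1.6 (iii) p. 35: "restricting cohomology classes of `Π_U` to the
  various `I_x` [...] where we identify `Hom_Ẑ(I_x, M_X)` with `Ẑ` via the isomorphism `I_x ⥲ M_X` of
  Proposition 1.4, (ii) [...] the image [via `κ_U`] of `Γ(U, 𝒪_U^×)` [...] is [...] determined by the
  principal divisors"; Thm. 1.9 (b) p. 37 "via the technique of Proposition 1.4, (ii)"): for cofinite opens
  `U ⊆ U_z ⊆ X` of the model with `X` proper, a cusp `z` of `U` whose inertia group maps BIJECTIVELY onto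
  the inertia group of the cusp `x` of `U_z` (Prop. 1.4 (i)), `(U_z ⊆ X, x)` a cyclotome presentation
  (`U_z = X ∖ {x}`, Prop. 1.4 (ii) exact), a regular unit `f` on `U` and the point `y ∈ X` that `z` fills,
  `κ_U(f)|_{I_z}` is the class of `i ↦ (degSign · ord_y(f)) · sync_x(i|_{U_z})` for THE synchronization. -/
  kummer_degree : ∀ {U Uz X : Curve} (h₁ : IsCofiniteOpen U Uz) (h₂ : IsCofiniteOpen Uz X)
    (h : IsCofiniteOpen U X) (hX : IsProper X) (z : (cusps U).Cusp) (x : (cusps Uz).Cusp)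
    (hp : toCurveModel.IsCyclotomePresentation h₂ x)
    (hle : ((cusps U).Icusp z).map (res h₁).arith.toMonoidHom ≤ (cusps Uz).Icusp x),
    Set.BijOn (res h₁).arith ((cusps U).Icusp z) ((cusps Uz).Icusp x) →
    ∀ (y : Point X), cuspPt h z = some y →
    ∀ (s : CcnSection (res h₂)) (hd : Function.Bijective (ccnTransgression (res h₂) ZHatCoeff.{u} s))
      (f : toDivisorCurveModel.regularUnits U),
      toCurveModel.HasDegreeAtCusp h₁ h₂ h z x hp.isCuspidallyCentral.le_cuspidalKernel hle s hd
        (Multiplicative.toAdd (kummerMap h hX f))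
        ((degSign : ℤ) *
          Multiplicative.toAdd (ord y (Units.map (fieldRes h).symm.toRingHom.toMonoidHom
            (f : (FunctionField U)ˣ))))
  /-- (S) **separation of closed points by decomposition groups** (OURS, from Prop. 1.6 (ii) p. 35:
  for `Z` proper of genus `≥ 1` over a Kummer-faithful field, conjugate decomposition groups of
  `x, y ∈ Z` make the degree-zero divisor `[x] − [y]` principal after a finite base change, hence
  `x = y`; the injectivity half of the section conjecture over Kummer-faithful fields): for `Z` a proper
  scheme-like curve of genus `≥ 2` over a Kummer-faithful field, closed points with `Π_Z`-conjugate
  decomposition groups are equal. -/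
  point_eq_of_decomp_conj : ∀ (Z : Curve), IsScheme Z → IsProper Z → 2 ≤ genus Z →
    IsKummerFaithful (base Z) → ∀ (x y : Point Z) (g : (ext Z).arith),
      decomp Z x = MulAut.conj g • decomp Z y → x = y
  /-- (E) the value `f(x) ∈ k^×` of a regular unit at a `k`-rational point ("`f(x) = 1`", Prop. 1.3 (c)
  p. 30; "`η|_x := s_x^*(η)`", Prop. 1.8 p. 36). -/
  evalAt : ∀ {U : Curve} (x : Point U), IsRationalPt U x →
    (toDivisorCurveModel.regularUnits U →* (base U)ˣ)
  /-- (E) the value of a constant is the constant. -/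
  evalAt_const : ∀ {U : Curve} (x : Point U) (hx : IsRationalPt U x) (c : (base U)ˣ)
    (hc : Units.map (algebraMap (base U) (FunctionField U) : base U →* FunctionField U) c ∈
      toDivisorCurveModel.regularUnits U), evalAt x hx ⟨_, hc⟩ = c
  /-- (E) **evaluation compatibility** ("`κ_U(f)|_x = η|_{G_{k_x}}`", Prop. 1.8 (ii) p. 36; the restriction
  of the Kummer class of `f` to the decomposition group of a rational point `x ∈ U(k)` is the Kummer
  class of the value `f(x)`): `κ_U(f)|_{D_x} = κ_U(f(x))|_{D_x}` for the constant regular unit `f(x)`. -/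
  kummerRes_decomp_evalAt : ∀ {U X : Curve} (h : IsCofiniteOpen U X) (hX : IsProper X) (x : Point U)
    (hx : IsRationalPt U x) (f : toDivisorCurveModel.regularUnits U)
    (hc : Units.map (algebraMap (base U) (FunctionField U) : base U →* FunctionField U)
      (evalAt x hx f) ∈ toDivisorCurveModel.regularUnits U),
    toIntrinsicKummerModel.kummerRes h hX (decomp U x) f =
      toIntrinsicKummerModel.kummerRes h hX (decomp U x) ⟨_, hc⟩
  /-- (E) **Kummer-faithfulness at a rational point** (Def. 1.5 p. 32: the Kummer map of `𝔾_m` over a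
  Kummer-faithful field is injective; `D_x ≅ G_k` for `x ∈ U(k)`): the Kummer class of a constant `c`
  restricted to `D_x` vanishes iff `c = 1`. -/
  kummerRes_decomp_const_eq_zero_iff : ∀ {U X : Curve} (h : IsCofiniteOpen U X) (hX : IsProper X)
    (x : Point U), IsRationalPt U x → IsKummerFaithful (base U) → ∀ (c : (base U)ˣ)
      (hc : Units.map (algebraMap (base U) (FunctionField U) : base U →* FunctionField U) c ∈
        toDivisorCurveModel.regularUnits U),
      toIntrinsicKummerModel.kummerRes h hX (decomp U x) ⟨_, hc⟩ = 0 ↔ c = 1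

end Literature.AnabelianGeometry.AbsoluteAnabelian.AbsTopIII
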